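import Summits.QuantumFields.BalabanUV.Beta.FP.EffFormTower
import Literature.MathematicalPhysics.QuantumFieldTheory.Balaban1983to89.Beta.GaugeFixingPropagators

/-!
# `BalabanUV.Beta.FP.TorusOneShotColumnGaugeProj` — road «FP» for binder row D1, ROUTE T (β1), SPEC-49 §B ∕ J-RISK-1 LOCATED (Q-FP-39-1):
# **THE ONE-SHOT MINIMISER COLUMN IS THE GAUGE PROJECTION OF THE NESTED COLUMN** — `minOp H [Q₂Q₁; P]·(v,0) = Π_P · (minOp H [Q₁;τ₁]·(minOp S₁₁ [Q₂;τ₂]·(v,0), 0))`,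
# `Π_P = 1 − W(PW)⁻¹P`; at the END wrapper's letters: `XN₁₂·(v,0) = hv v − W₀·((P·W₀)⁻¹·(P·hv v))`

WHY.  The END wrapper `StepRecursionFeedNestedNamedB.d1Tel_JcComp_ctr_named` (p405971 ✓) pins the road's finest-level direction to the NESTED composite column
`hv n B v = I · (minOp S₁₁ [Q₂₀; τ₂] · (v, 0), 0)` (`hhv`; `I = minOp H₀ [Q₁₀; τ₁]`, `S = effForm H₀ [Q₁₀; τ₁]`, `τ₁ = bigP … n` the LOWER big comb, `τ₂ = combF …` the top
comb ON THE COMPOSITE AVERAGES), while its (S3-1) N system is the ONE-SHOT depth-(n+2) system `kkt H₀ [𝔔₀; P]` (`𝔔₀ = Q₂₀Q₁₀`, `P = bigP … (n+1)` the big comb ON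
THE FINEST FIELDS) with right inverse `XN` (`hXN`) whose blocks the N leg `hLN` reads as the periodised N-chart `perF T (AN R (n+1))` — the column an2's `VN` and
the binder `hHN₁` see.  The two columns solve the same Euler–Lagrange rows (`H₀·h = 𝔔₀ᵀλ′`, `𝔔₀·h = v`) for DIFFERENT gauge slices, so (an2's Literature
`GaugeFixingPropagators.blocks_sliceChange₃`, «changing the gauge fixing gauge-transforms the minimal configuration onto the new slice») the one-shot column is the
GAUGE PROJECTION `Π_P = 1 − W₀(PW₀)⁻¹P` of the nested one: they differ by the exact tower mode `W₀·θ(v)`, `θ(v) = (PW₀)⁻¹·P·hv v`.  Hence SPEC-49 §B's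
(J-W) TERMWISE (`(−2c)·hv(dv)_b = cE·colN_b` for every bond) holds only where `θ(dv) = 0`, and the binding `hHN₁` must be read with #21's conjugation
parameter `λ := lv v` = the slice-change parameter (option (i) of an2 g61's W-1), NOT `lv := 0` (R-FP-77 (ii)) — RULING R-FP-79 in the journal.  THIS FILE
types the identity; every side letter it displays (`H₀W₀ = 0`, `H₀ᵀ = H₀` or `H₀ᵀW₀ = 0`, `𝔔₀W₀ = 0`, the two transversalities, the fine and coarse (INV)) is
already discharged BY NAME inside #21-GB ∕ #21-SymB ∕ `TowerKernelLawNamedB` (`torus_a0_tower`, `torus_H₀_transpose_comb`, `compWard_b0` over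
`compRowsSym_mul_towerGen_succ ∕ QtopSym_mul_smul_tgrad_res`, `torus_hTW_oneShot_towerSym`, `det_bigP_mul_towerGen_ne_zero`, `torus_composite_inv_and_eff_G` +
`isUnit_det_kkt_sliceChange₃`, `torus_isUnit_det_kkt_combRows_comb`).

WHAT ([folklore] Schur-complement ∕ slice-change bookkeeping over an arbitrary field BY NAME; no `def`, no `def … : Prop`, nothing cited, 0 sorry):
* §1 `minOp_killRows_mulVec` (`minOp E [[P,0],[0,1]]·(c,0) = (minOp E₁₁ P·c, 0)`, leaf-05 `EffFormTower.minOp_killRows` + `mul_minOp`), `minOp_submatrix_rows`,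
  `minOp_submatrix_rows_mulVec` (re-indexing the constraint rows), `isUnit_det_kkt_nested` ∕ `isUnit_det_kkt_nested_assoc` (the nested-sliced one-shot system is
  non-degenerate from the fine and coarse (INV) — an5 `isUnit_det_kkt_compForm` at `G := 0`), **`minOp_nested_mulVec`** ∕ **`minOp_nested_assoc_mulVec`**
  (`minOp H [Q₂Q₁; [τ₂Q₁; τ₁]]·(v,0) = minOp H [Q₁;τ₁]·(minOp S₁₁ [Q₂;τ₂]·(v,0), 0)` — an5 `minOp_compForm` at `G := 0` + §1's pinning).
* §2 **`oneShot_minOp_mulVec_eq_gaugeProj_nested`**: for a one-shot slice `P` and generators `W` with `HW = 0`, `HᵀW = 0`, `Q₂Q₁W = 0`, `det([τ₂Q₁;τ₁]·W)`,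
  `det(P·W)` units: `minOp H [Q₂Q₁; P]·(v,0) = (1 − W(PW)⁻¹P)·(minOp H [Q₁;τ₁]·(minOp S₁₁ [Q₂;τ₂]·(v,0), 0))`, and `isUnit_det_kkt_oneShot` (solvability across
  the slice change).
* §3 AT THE END WRAPPER's LETTERS (`hI hS hhv h𝔔₀ hXN` VERBATIM as binder shapes; the side letters displayed): **`XN_toBlocks₁₂_mulVec_eq_gaugeProj`**:
  `XN.toBlocks₁₂·(v,0) = hv v − W₀·((P·W₀)⁻¹·(P·hv v))` and its bond-wise reading `XN_inl_inr_inl_sum_eq`.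
WHAT THIS IS NOT: not the instantiation of `lv` (the site function of `W₀θ` — `towerGen`'s columns are torus gradients of the modes' indicator functions,
`TorusCompositeFP.evalN`; next file), not (J-X) (the Wilson cubic vertex along an exact direction = #21's commutator), not (J-Λ); no row of the END wrapper
discharged; nothing of Bałaban's asserted, valued or discharged; 0 estimates; 0∕4 row-D1 binders (hW, hR, D1Tel, D1Rep); ROOT M‴ p325680 untouched;
NOT (C1), NOT (L2′), NOT (T-ID), NOT SDF, NOT D1, NOT BetaPertH, NOT continuum, NOT Clay.

HONEST DEPENDENCY (page 1, mandatory): continuum YM on T⁴ ⇐ BetaPertH ∧ nine spine estimates (0/9 proved); BetaPertH ⇐ (D1) ∧ (D4) ∧ CAP+tail;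
G-an2-4 gates asym, D1 and NE2/3/4.  HONEST FRAMING (cell contract, verbatim): «discharging `BetaPertH` makes Bałaban's UV stability UNCONDITIONAL —
a real constructive-QFT result; it is NOT the continuum limit and NOT the Clay problem.»  ABSOLUTE RULE (cell charter, verbatim): «No internally-minted
statement may enter as a cited fact. Every hypothesis is either kernel-proved in this package or a verbatim quotation of a PUBLISHED theorem with page
reference. The manuscript(s) under audit are NOT citable for their own disputed steps — they are the thing under adjudication; programme-internal
(2001/route/tribunal) claims are never citable.»  Road «FP» OWNER, b2b-balaban-beta-d1-p3 gen 39, 2026-08-27.  No existing file touched.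
-/

noncomputable section

namespace Summit.QuantumFields.BalabanUV.Beta.FP.TorusOneShotColumnGaugeProj

open Matrix
open Literature.MathematicalPhysics.QuantumFieldTheory.Balaban1983to89.Beta.Composition (kkt compForm)
open Literature.MathematicalPhysics.QuantumFieldTheory.Balaban1983to89.Beta.CompositionSingular (effForm minOp minOp_compForm mul_minOp
  isUnit_det_kkt_compForm)
open Literature.MathematicalPhysics.QuantumFieldTheory.Balaban1983to89.Beta.GaugeFixingPropagators (blocks_sliceChange₃ isUnit_det_kkt_sliceChange₃)
open Literature.MathematicalPhysics.QuantumFieldTheory.Balaban1983to89.Beta.SliceComposition (fromRows_assoc)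
open Summit.QuantumFields.BalabanUV.Beta.FP.KKTCornerReduction (det_kkt_killRows)
open Summit.QuantumFields.BalabanUV.Beta.FP.EffFormTower (minOp_killRows)
open Summit.QuantumFields.BalabanUV.Beta.FP.NestedStepLawSliced (nestedSlice_mul_fromRows)
open Summit.QuantumFields.BalabanUV.Beta.FP.RelInvPeriodisedSliced (kkt_submatrix_equiv det_kkt_submatrix_equiv)

variable {𝕜 : Type*} [Field 𝕜]

/-! ## §1 Pinning, re-indexing and the nested column as a one-shot minimiser for the nested slice -/

section Pinning

variable {μ κ ρ : Type*} [Fintype μ] [Fintype κ] [Fintype ρ] [DecidableEq μ] [DecidableEq κ] [DecidableEq ρ]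

/-- [folklore] **KILLING VARIABLES BY A CONSTRAINT ROW, minimiser column**: `minOp E [[P,0],[0,1]] · (c, 0) = (minOp E₁₁ P · c, 0)` — the `μ`-rows are the
corner system's minimiser (leaf-05 `EffFormTower.minOp_killRows`), the killed `ρ`-rows vanish (the constraint row `[0 1]` of `mul_minOp`). -/
theorem minOp_killRows_mulVec (E : Matrix (μ ⊕ ρ) (μ ⊕ ρ) 𝕜) (P : Matrix κ μ 𝕜) (h : IsUnit (kkt E.toBlocks₁₁ P).det) (c : κ → 𝕜) :
    minOp E (fromBlocks P (0 : Matrix κ ρ 𝕜) (0 : Matrix ρ μ 𝕜) (1 : Matrix ρ ρ 𝕜)) *ᵥ Sum.elim c 0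
      = Sum.elim (minOp E.toBlocks₁₁ P *ᵥ c) 0 := by
  have h' : IsUnit (kkt E (fromBlocks P (0 : Matrix κ ρ 𝕜) (0 : Matrix ρ μ 𝕜) (1 : Matrix ρ ρ 𝕜))).det := by
    rw [det_kkt_killRows]
    exact ((isUnit_neg_one (α := 𝕜)).pow _).mul h
  ext (i | r)
  · rw [Sum.elim_inl, ← minOp_killRows E P h]
    simp only [mulVec, dotProduct, Fintype.sum_sum_type, Sum.elim_inl, Sum.elim_inr, Pi.zero_apply, mul_zero, Finset.sum_const_zero, add_zero,
      submatrix_apply]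
  · have e := congrArg (fun X : Matrix ((κ ⊕ ρ)) ((κ ⊕ ρ)) 𝕜 => (X *ᵥ Sum.elim c (0 : ρ → 𝕜)) (Sum.inr r))
      (mul_minOp E (fromBlocks P (0 : Matrix κ ρ 𝕜) (0 : Matrix ρ μ 𝕜) (1 : Matrix ρ ρ 𝕜)) h')
    simp only [← mulVec_mulVec, fromBlocks_mulVec, zero_mulVec, one_mulVec, zero_add, Sum.elim_inr, Pi.zero_apply] at e
    simpa using e

end Pinning

section Reindex

variable {ν σ κ' : Type*} [Fintype ν] [Fintype σ] [Fintype κ'] [DecidableEq ν] [DecidableEq σ] [DecidableEq κ']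

/-- [folklore] **RE-INDEXING THE CONSTRAINT ROWS re-indexes the minimiser's columns**: `minOp H (C∘(f, id)) = (minOp H C)∘(id, f)` (the twin of leaf-05's
`EffFormTower.effForm_submatrix_rows`). -/
theorem minOp_submatrix_rows (H : Matrix ν ν 𝕜) (C : Matrix σ ν 𝕜) (f : κ' ≃ σ) :
    minOp H (C.submatrix f id) = (minOp H C).submatrix id f := by
  ext x k
  change ((kkt H (C.submatrix f id))⁻¹) (Sum.inl x) (Sum.inr k) = ((kkt H C)⁻¹) (Sum.inl x) (Sum.inr (f k))
  have hc : (Sum.map (Equiv.refl ν) f : ν ⊕ κ' → ν ⊕ σ) = (Equiv.sumCongr (Equiv.refl ν) f) := rfl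
  rw [show C.submatrix f id = C.submatrix f (Equiv.refl ν) from rfl, show H = H.submatrix (Equiv.refl ν) (Equiv.refl ν) from rfl,
    kkt_submatrix_equiv, hc, Matrix.inv_submatrix_equiv]
  rfl

/-- [folklore] … so on a source the re-indexed minimiser reads the re-indexed source: `minOp H (C∘(f,id)) · w = minOp H C · (w ∘ f⁻¹)`. -/
theorem minOp_submatrix_rows_mulVec (H : Matrix ν ν 𝕜) (C : Matrix σ ν 𝕜) (f : κ' ≃ σ) (w : κ' → 𝕜) :
    minOp H (C.submatrix f id) *ᵥ w = minOp H C *ᵥ (w ∘ f.symm) := by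
  rw [minOp_submatrix_rows, show (minOp H C).submatrix id f = (minOp H C).submatrix id (f : κ' → σ) from rfl,
    ← show (minOp H C).submatrix (id : ν → ν) ⇑f = (minOp H C).submatrix id f from rfl, Matrix.submatrix_mulVec_equiv]
  rfl

end Reindex

section Nested

variable {ν μ κ ρ₁ ρ₂ : Type*} [Fintype ν] [Fintype μ] [Fintype κ] [Fintype ρ₁] [Fintype ρ₂]
  [DecidableEq ν] [DecidableEq μ] [DecidableEq κ] [DecidableEq ρ₁] [DecidableEq ρ₂]

/-- [folklore] **THE NESTED-SLICED ONE-SHOT SYSTEM IS NON-DEGENERATE** (product form): `kkt H ([[Q₂,0],[τ₂,0],[0,1]]·[Q₁;τ₁])` is invertible as soon as the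
fine sliced system `kkt H [Q₁;τ₁]` and the coarse sliced system `kkt S₁₁ [Q₂;τ₂]` (`S = effForm H [Q₁;τ₁]`) are — an5 `isUnit_det_kkt_compForm` at `G := 0`
and the OWNER's `det_kkt_killRows`. -/
theorem isUnit_det_kkt_nested (H : Matrix ν ν 𝕜) (Q₁ : Matrix μ ν 𝕜) (τ₁ : Matrix ρ₁ ν 𝕜) (Q₂ : Matrix κ μ 𝕜) (τ₂ : Matrix ρ₂ μ 𝕜)
    {S : Matrix (μ ⊕ ρ₁) (μ ⊕ ρ₁) 𝕜} (hS : effForm H (fromRows Q₁ τ₁) = S)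
    (h1 : IsUnit (kkt H (fromRows Q₁ τ₁)).det) (h2 : IsUnit (kkt S.toBlocks₁₁ (fromRows Q₂ τ₂)).det) :
    IsUnit (kkt H (fromBlocks (fromRows Q₂ τ₂) (0 : Matrix (κ ⊕ ρ₂) ρ₁ 𝕜) (0 : Matrix ρ₁ μ 𝕜) (1 : Matrix ρ₁ ρ₁ 𝕜) * fromRows Q₁ τ₁)).det := by
  have hc : compForm H (fromRows Q₁ τ₁) 0 = H := by simp [compForm]
  have h2' : IsUnit (kkt (effForm H (fromRows Q₁ τ₁) + 0)
      (fromBlocks (fromRows Q₂ τ₂) (0 : Matrix (κ ⊕ ρ₂) ρ₁ 𝕜) (0 : Matrix ρ₁ μ 𝕜) (1 : Matrix ρ₁ ρ₁ 𝕜))).det := by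
    rw [add_zero, hS, det_kkt_killRows]
    exact ((isUnit_neg_one (α := 𝕜)).pow _).mul h2
  have e := isUnit_det_kkt_compForm H (fromRows Q₁ τ₁) 0
    (fromBlocks (fromRows Q₂ τ₂) (0 : Matrix (κ ⊕ ρ₂) ρ₁ 𝕜) (0 : Matrix ρ₁ μ 𝕜) (1 : Matrix ρ₁ ρ₁ 𝕜)) h1 h2'
  rwa [hc] at e

/-- [folklore] the same, multiplied out: `kkt H [[Q₂Q₁; τ₂Q₁]; τ₁]` is invertible. -/
theorem isUnit_det_kkt_nested' (H : Matrix ν ν 𝕜) (Q₁ : Matrix μ ν 𝕜) (τ₁ : Matrix ρ₁ ν 𝕜) (Q₂ : Matrix κ μ 𝕜) (τ₂ : Matrix ρ₂ μ 𝕜)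
    {S : Matrix (μ ⊕ ρ₁) (μ ⊕ ρ₁) 𝕜} (hS : effForm H (fromRows Q₁ τ₁) = S)
    (h1 : IsUnit (kkt H (fromRows Q₁ τ₁)).det) (h2 : IsUnit (kkt S.toBlocks₁₁ (fromRows Q₂ τ₂)).det) :
    IsUnit (kkt H (fromRows (fromRows (Q₂ * Q₁) (τ₂ * Q₁)) τ₁)).det := by
  rw [← nestedSlice_mul_fromRows]
  exact isUnit_det_kkt_nested H Q₁ τ₁ Q₂ τ₂ hS h1 h2

/-- [folklore] the same, RE-ASSOCIATED as the door's one-shot constraint `[Q₂Q₁; [τ₂Q₁; τ₁]]` (composite averaging ⊕ nested slice). -/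
theorem isUnit_det_kkt_nested_assoc (H : Matrix ν ν 𝕜) (Q₁ : Matrix μ ν 𝕜) (τ₁ : Matrix ρ₁ ν 𝕜) (Q₂ : Matrix κ μ 𝕜) (τ₂ : Matrix ρ₂ μ 𝕜)
    {S : Matrix (μ ⊕ ρ₁) (μ ⊕ ρ₁) 𝕜} (hS : effForm H (fromRows Q₁ τ₁) = S)
    (h1 : IsUnit (kkt H (fromRows Q₁ τ₁)).det) (h2 : IsUnit (kkt S.toBlocks₁₁ (fromRows Q₂ τ₂)).det) :
    IsUnit (kkt H (fromRows (Q₂ * Q₁) (fromRows (τ₂ * Q₁) τ₁))).det := by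
  rw [fromRows_assoc, show H = H.submatrix (Equiv.refl ν) (Equiv.refl ν) from rfl,
    show ((fromRows (fromRows (Q₂ * Q₁) (τ₂ * Q₁)) τ₁).submatrix (Equiv.sumAssoc κ ρ₂ ρ₁).symm id) =
      (fromRows (fromRows (Q₂ * Q₁) (τ₂ * Q₁)) τ₁).submatrix (Equiv.sumAssoc κ ρ₂ ρ₁).symm (Equiv.refl ν) from rfl, det_kkt_submatrix_equiv]
  exact isUnit_det_kkt_nested' H Q₁ τ₁ Q₂ τ₂ hS h1 h2

/-- [folklore] **THE NESTED COLUMN IS THE ONE-SHOT MINIMISER FOR THE NESTED SLICE** (product form): with `S := effForm H [Q₁;τ₁]`,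
`minOp H ([[Q₂,0],[τ₂,0],[0,1]]·[Q₁;τ₁]) · ((v,0),0) = minOp H [Q₁;τ₁] · (minOp S₁₁ [Q₂;τ₂] · (v,0), 0)` — an5's composition of minimisers at `G := 0`
followed by §1's pinning. -/
theorem minOp_nested_mulVec_prod (H : Matrix ν ν 𝕜) (Q₁ : Matrix μ ν 𝕜) (τ₁ : Matrix ρ₁ ν 𝕜) (Q₂ : Matrix κ μ 𝕜) (τ₂ : Matrix ρ₂ μ 𝕜)
    {S : Matrix (μ ⊕ ρ₁) (μ ⊕ ρ₁) 𝕜} (hS : effForm H (fromRows Q₁ τ₁) = S)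
    (h1 : IsUnit (kkt H (fromRows Q₁ τ₁)).det) (h2 : IsUnit (kkt S.toBlocks₁₁ (fromRows Q₂ τ₂)).det) (v : κ → 𝕜) :
    minOp H (fromBlocks (fromRows Q₂ τ₂) (0 : Matrix (κ ⊕ ρ₂) ρ₁ 𝕜) (0 : Matrix ρ₁ μ 𝕜) (1 : Matrix ρ₁ ρ₁ 𝕜) * fromRows Q₁ τ₁)
        *ᵥ Sum.elim (Sum.elim v 0) 0
      = minOp H (fromRows Q₁ τ₁) *ᵥ Sum.elim (minOp S.toBlocks₁₁ (fromRows Q₂ τ₂) *ᵥ Sum.elim v 0) 0 := by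
  have hc : compForm H (fromRows Q₁ τ₁) 0 = H := by simp [compForm]
  have h2' : IsUnit (kkt (effForm H (fromRows Q₁ τ₁) + 0)
      (fromBlocks (fromRows Q₂ τ₂) (0 : Matrix (κ ⊕ ρ₂) ρ₁ 𝕜) (0 : Matrix ρ₁ μ 𝕜) (1 : Matrix ρ₁ ρ₁ 𝕜))).det := by
    rw [add_zero, hS, det_kkt_killRows]
    exact ((isUnit_neg_one (α := 𝕜)).pow _).mul h2
  have e := minOp_compForm H (fromRows Q₁ τ₁) 0
    (fromBlocks (fromRows Q₂ τ₂) (0 : Matrix (κ ⊕ ρ₂) ρ₁ 𝕜) (0 : Matrix ρ₁ μ 𝕜) (1 : Matrix ρ₁ ρ₁ 𝕜)) h1 h2'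
  rw [hc, add_zero, hS] at e
  rw [e, ← mulVec_mulVec, minOp_killRows_mulVec S (fromRows Q₂ τ₂) h2]

/-- [folklore] the same, multiplied out: `minOp H [[Q₂Q₁; τ₂Q₁]; τ₁] · ((v,0),0) = minOp H [Q₁;τ₁] · (minOp S₁₁ [Q₂;τ₂] · (v,0), 0)`. -/
theorem minOp_nested_mulVec (H : Matrix ν ν 𝕜) (Q₁ : Matrix μ ν 𝕜) (τ₁ : Matrix ρ₁ ν 𝕜) (Q₂ : Matrix κ μ 𝕜) (τ₂ : Matrix ρ₂ μ 𝕜)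
    {S : Matrix (μ ⊕ ρ₁) (μ ⊕ ρ₁) 𝕜} (hS : effForm H (fromRows Q₁ τ₁) = S)
    (h1 : IsUnit (kkt H (fromRows Q₁ τ₁)).det) (h2 : IsUnit (kkt S.toBlocks₁₁ (fromRows Q₂ τ₂)).det) (v : κ → 𝕜) :
    minOp H (fromRows (fromRows (Q₂ * Q₁) (τ₂ * Q₁)) τ₁) *ᵥ Sum.elim (Sum.elim v 0) 0
      = minOp H (fromRows Q₁ τ₁) *ᵥ Sum.elim (minOp S.toBlocks₁₁ (fromRows Q₂ τ₂) *ᵥ Sum.elim v 0) 0 := by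
  rw [← nestedSlice_mul_fromRows]
  exact minOp_nested_mulVec_prod H Q₁ τ₁ Q₂ τ₂ hS h1 h2 v

/-- [folklore] **THE NESTED COLUMN, door grouping**: `minOp H [Q₂Q₁; [τ₂Q₁; τ₁]] · (v, 0) = minOp H [Q₁;τ₁] · (minOp S₁₁ [Q₂;τ₂] · (v,0), 0)` — the source
`(v, 0)` with `0` on the whole nested slice `ρ₂ ⊕ ρ₁`. -/
theorem minOp_nested_assoc_mulVec (H : Matrix ν ν 𝕜) (Q₁ : Matrix μ ν 𝕜) (τ₁ : Matrix ρ₁ ν 𝕜) (Q₂ : Matrix κ μ 𝕜) (τ₂ : Matrix ρ₂ μ 𝕜)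
    {S : Matrix (μ ⊕ ρ₁) (μ ⊕ ρ₁) 𝕜} (hS : effForm H (fromRows Q₁ τ₁) = S)
    (h1 : IsUnit (kkt H (fromRows Q₁ τ₁)).det) (h2 : IsUnit (kkt S.toBlocks₁₁ (fromRows Q₂ τ₂)).det) (v : κ → 𝕜) :
    minOp H (fromRows (Q₂ * Q₁) (fromRows (τ₂ * Q₁) τ₁)) *ᵥ Sum.elim v 0
      = minOp H (fromRows Q₁ τ₁) *ᵥ Sum.elim (minOp S.toBlocks₁₁ (fromRows Q₂ τ₂) *ᵥ Sum.elim v 0) 0 := by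
  rw [fromRows_assoc, minOp_submatrix_rows_mulVec, ← minOp_nested_mulVec H Q₁ τ₁ Q₂ τ₂ hS h1 h2 v]
  congr 1
  ext ((k | r) | r) <;> rfl

end Nested

/-! ## §2 The one-shot column is the gauge projection of the nested column -/

section SliceChange

variable {ν μ κ ρ₁ ρ₂ : Type*} [Fintype ν] [Fintype μ] [Fintype κ] [Fintype ρ₁] [Fintype ρ₂]
  [DecidableEq ν] [DecidableEq μ] [DecidableEq κ] [DecidableEq ρ₁] [DecidableEq ρ₂]

/-- [folklore] **SOLVABILITY OF THE ONE-SHOT SYSTEM ACROSS THE SLICE CHANGE**: with generators `W` killed by `H`, `Hᵀ` and the composite averaging `Q₂Q₁`,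
transversal to the nested slice `[τ₂Q₁; τ₁]` and to the one-shot slice `P`, the one-shot bordered matrix `kkt H [Q₂Q₁; P]` is invertible as soon as the
fine and coarse sliced systems are (an2's Literature `isUnit_det_kkt_sliceChange₃` over §1's `isUnit_det_kkt_nested_assoc`). -/
theorem isUnit_det_kkt_oneShot (H : Matrix ν ν 𝕜) (Q₁ : Matrix μ ν 𝕜) (τ₁ : Matrix ρ₁ ν 𝕜) (Q₂ : Matrix κ μ 𝕜) (τ₂ : Matrix ρ₂ μ 𝕜)
    (P : Matrix (ρ₂ ⊕ ρ₁) ν 𝕜) (W : Matrix ν (ρ₂ ⊕ ρ₁) 𝕜)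
    {S : Matrix (μ ⊕ ρ₁) (μ ⊕ ρ₁) 𝕜} (hS : effForm H (fromRows Q₁ τ₁) = S)
    (h1 : IsUnit (kkt H (fromRows Q₁ τ₁)).det) (h2 : IsUnit (kkt S.toBlocks₁₁ (fromRows Q₂ τ₂)).det)
    (hKW : H * W = 0) (hKtW : Hᵀ * W = 0) (hQW : Q₂ * Q₁ * W = 0)
    (hT : IsUnit (fromRows (τ₂ * Q₁) τ₁ * W).det) (hP : IsUnit (P * W).det) :
    IsUnit (kkt H (fromRows (Q₂ * Q₁) P)).det :=
  isUnit_det_kkt_sliceChange₃ H (Q₂ * Q₁) (fromRows (τ₂ * Q₁) τ₁) P W hKW hKtW hQW hT hP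
    (isUnit_det_kkt_nested_assoc H Q₁ τ₁ Q₂ τ₂ hS h1 h2)

/-- [folklore] **THE ONE-SHOT MINIMISER COLUMN IS THE GAUGE PROJECTION OF THE NESTED COLUMN**:
`minOp H [Q₂Q₁; P] · (v, 0) = (1 − W(PW)⁻¹P) · (minOp H [Q₁;τ₁] · (minOp S₁₁ [Q₂;τ₂] · (v,0), 0))` — an2's Literature `blocks_sliceChange₃` («changing the
gauge fixing gauge-transforms the minimal configuration onto the new slice») from the nested slice `[τ₂Q₁; τ₁]` to the one-shot slice `P`, composed with
§1's identification of the nested column.  The two columns DIFFER by the exact mode `W·((PW)⁻¹·(P·h_nested))`. -/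
theorem oneShot_minOp_mulVec_eq_gaugeProj_nested (H : Matrix ν ν 𝕜) (Q₁ : Matrix μ ν 𝕜) (τ₁ : Matrix ρ₁ ν 𝕜) (Q₂ : Matrix κ μ 𝕜)
    (τ₂ : Matrix ρ₂ μ 𝕜) (P : Matrix (ρ₂ ⊕ ρ₁) ν 𝕜) (W : Matrix ν (ρ₂ ⊕ ρ₁) 𝕜)
    {S : Matrix (μ ⊕ ρ₁) (μ ⊕ ρ₁) 𝕜} (hS : effForm H (fromRows Q₁ τ₁) = S)
    (h1 : IsUnit (kkt H (fromRows Q₁ τ₁)).det) (h2 : IsUnit (kkt S.toBlocks₁₁ (fromRows Q₂ τ₂)).det)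
    (hKW : H * W = 0) (hKtW : Hᵀ * W = 0) (hQW : Q₂ * Q₁ * W = 0)
    (hT : IsUnit (fromRows (τ₂ * Q₁) τ₁ * W).det) (hP : IsUnit (P * W).det) (v : κ → 𝕜) :
    minOp H (fromRows (Q₂ * Q₁) P) *ᵥ Sum.elim v 0
      = (1 - W * (P * W)⁻¹ * P) *ᵥ (minOp H (fromRows Q₁ τ₁) *ᵥ Sum.elim (minOp S.toBlocks₁₁ (fromRows Q₂ τ₂) *ᵥ Sum.elim v 0) 0) := by
  have hb := (blocks_sliceChange₃ H (Q₂ * Q₁) (fromRows (τ₂ * Q₁) τ₁) P W hKW hKtW hQW hT hP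
    (isUnit_det_kkt_nested_assoc H Q₁ τ₁ Q₂ τ₂ hS h1 h2)).2.1
  rw [hb, fromCols_mulVec_sumElim, mulVec_zero, add_zero, ← minOp_nested_assoc_mulVec H Q₁ τ₁ Q₂ τ₂ hS h1 h2 v, ← mulVec_mulVec]
  congr 1
  ext x
  simp only [mulVec, dotProduct, Fintype.sum_sum_type, Sum.elim_inl, Sum.elim_inr, Pi.zero_apply, mul_zero, Finset.sum_const_zero, add_zero]
  rfl

/-- [folklore] the same with the projection written out: `one-shot column = nested column − W·((PW)⁻¹·(P·nested column))`. -/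
theorem oneShot_minOp_mulVec_eq_nested_sub (H : Matrix ν ν 𝕜) (Q₁ : Matrix μ ν 𝕜) (τ₁ : Matrix ρ₁ ν 𝕜) (Q₂ : Matrix κ μ 𝕜)
    (τ₂ : Matrix ρ₂ μ 𝕜) (P : Matrix (ρ₂ ⊕ ρ₁) ν 𝕜) (W : Matrix ν (ρ₂ ⊕ ρ₁) 𝕜)
    {S : Matrix (μ ⊕ ρ₁) (μ ⊕ ρ₁) 𝕜} (hS : effForm H (fromRows Q₁ τ₁) = S)
    (h1 : IsUnit (kkt H (fromRows Q₁ τ₁)).det) (h2 : IsUnit (kkt S.toBlocks₁₁ (fromRows Q₂ τ₂)).det)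
    (hKW : H * W = 0) (hKtW : Hᵀ * W = 0) (hQW : Q₂ * Q₁ * W = 0)
    (hT : IsUnit (fromRows (τ₂ * Q₁) τ₁ * W).det) (hP : IsUnit (P * W).det) (v : κ → 𝕜) :
    minOp H (fromRows (Q₂ * Q₁) P) *ᵥ Sum.elim v 0
      = minOp H (fromRows Q₁ τ₁) *ᵥ Sum.elim (minOp S.toBlocks₁₁ (fromRows Q₂ τ₂) *ᵥ Sum.elim v 0) 0
        - W *ᵥ ((P * W)⁻¹ *ᵥ (P *ᵥ (minOp H (fromRows Q₁ τ₁) *ᵥ Sum.elim (minOp S.toBlocks₁₁ (fromRows Q₂ τ₂) *ᵥ Sum.elim v 0) 0))) := by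
  rw [oneShot_minOp_mulVec_eq_gaugeProj_nested H Q₁ τ₁ Q₂ τ₂ P W hS h1 h2 hKW hKtW hQW hT hP v, sub_mulVec, one_mulVec, ← mulVec_mulVec,
    ← mulVec_mulVec]

end SliceChange

/-! ## §3 At the END wrapper's letters: `XN₁₂·(v,0) = hv v − W₀·((P·W₀)⁻¹·(P·hv v))` -/

section Wrapper

variable {ν μ κ ρ₁ ρ₂ : Type*} [Fintype ν] [Fintype μ] [Fintype κ] [Fintype ρ₁] [Fintype ρ₂]
  [DecidableEq ν] [DecidableEq μ] [DecidableEq κ] [DecidableEq ρ₁] [DecidableEq ρ₂]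

/-- [folklore] **`XN_toBlocks₁₂_mulVec_eq_gaugeProj` — THE END WRAPPER's N COLUMN IS THE GAUGE PROJECTION OF ITS NESTED DIRECTION.**  Binder SHAPES = the
wrapper's (`StepRecursionFeedNestedNamedB` at depth `n`, box `B`): `ν` the finest fields `pbox T × Fin 4`, `μ` the fields of `fine Lc (Mc B)`, `κ` the coarse
slots `pbox (Mc B) × Fin 4`, `ρ₁ = NParam … n` (lower nested parameters, `τ₁ = bigP … n`), `ρ₂ = Res …` (top comb, `τ₂ = combF …`), `P = bigP … (n+1)`,
`W₀ = towerGen … (n+1)`; `hI hS hhv h𝔔₀ hXN` VERBATIM; the side letters `a0` (`H₀W₀ = 0`), `hH₀t`, `b0` (`𝔔₀W₀ = 0`), `hTW`, `hPW`, `h1`, `h2` DISPLAYED (their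
by-name dischargers are listed in the file header).  CONCLUSION: `XN.toBlocks₁₂ · (v, 0) = hv v − W₀·((P·W₀)⁻¹·(P·hv v))` for every top source `v`. -/
theorem XN_toBlocks₁₂_mulVec_eq_gaugeProj
    {H₀ : Matrix ν ν 𝕜} {Q₁₀ : Matrix μ ν 𝕜} {τ₁ : Matrix ρ₁ ν 𝕜} {Q₂₀ : Matrix κ μ 𝕜} {τ₂ : Matrix ρ₂ μ 𝕜}
    {W₀ : Matrix ν (ρ₂ ⊕ ρ₁) 𝕜} {P : Matrix (ρ₂ ⊕ ρ₁) ν 𝕜}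
    {I : Matrix ν (μ ⊕ ρ₁) 𝕜} {S : Matrix (μ ⊕ ρ₁) (μ ⊕ ρ₁) 𝕜} {𝔔₀ : Matrix κ ν 𝕜}
    (hI : minOp H₀ (fromRows Q₁₀ τ₁) = I) (hS : effForm H₀ (fromRows Q₁₀ τ₁) = S)
    {hv : (κ → 𝕜) → (ν → 𝕜)} (hhv : ∀ v, hv v = I *ᵥ Sum.elim (minOp S.toBlocks₁₁ (fromRows Q₂₀ τ₂) *ᵥ Sum.elim v 0) 0)
    (h𝔔₀ : Q₂₀ * Q₁₀ = 𝔔₀)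
    {XN : Matrix (ν ⊕ (κ ⊕ (ρ₂ ⊕ ρ₁))) (ν ⊕ (κ ⊕ (ρ₂ ⊕ ρ₁))) 𝕜} (hXN : kkt H₀ (fromRows 𝔔₀ P) * XN = 1)
    -- the side letters (all discharged by name at the wrapper's pins inside #21-GB ∕ #21-SymB ∕ `TowerKernelLawNamedB`)
    (a0 : H₀ * W₀ = 0) (hH₀t : H₀ᵀ = H₀) (b0 : 𝔔₀ * W₀ = 0)
    (hTW : (fromRows (τ₂ * Q₁₀) τ₁ * W₀).det ≠ 0) (hPW : (P * W₀).det ≠ 0)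
    (h1 : (kkt H₀ (fromRows Q₁₀ τ₁)).det ≠ 0) (h2 : (kkt S.toBlocks₁₁ (fromRows Q₂₀ τ₂)).det ≠ 0) (v : κ → 𝕜) :
    XN.toBlocks₁₂ *ᵥ Sum.elim v 0 = hv v - W₀ *ᵥ ((P * W₀)⁻¹ *ᵥ (P *ᵥ hv v)) := by
  have hQW : Q₂₀ * Q₁₀ * W₀ = 0 := by rw [h𝔔₀]; exact b0
  have hKtW : H₀ᵀ * W₀ = 0 := by rw [hH₀t]; exact a0
  have hdet : IsUnit (kkt H₀ (fromRows 𝔔₀ P)).det := by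
    rw [← h𝔔₀]
    exact isUnit_det_kkt_oneShot H₀ Q₁₀ τ₁ Q₂₀ τ₂ P W₀ hS (isUnit_iff_ne_zero.mpr h1) (isUnit_iff_ne_zero.mpr h2) a0 hKtW hQW
      (isUnit_iff_ne_zero.mpr hTW) (isUnit_iff_ne_zero.mpr hPW)
  have hX : XN = (kkt H₀ (fromRows 𝔔₀ P))⁻¹ := (Matrix.inv_eq_right_inv hXN).symm
  have h12 : XN.toBlocks₁₂ = minOp H₀ (fromRows 𝔔₀ P) := by rw [hX]; rfl
  rw [h12, hhv v, ← hI, ← h𝔔₀]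
  exact oneShot_minOp_mulVec_eq_nested_sub H₀ Q₁₀ τ₁ Q₂₀ τ₂ P W₀ hS (isUnit_iff_ne_zero.mpr h1) (isUnit_iff_ne_zero.mpr h2) a0 hKtW hQW
    (isUnit_iff_ne_zero.mpr hTW) (isUnit_iff_ne_zero.mpr hPW) v

/-- [folklore] **BOND-WISE READING**: for every finest bond `b` and top source `v`,
`Σ_a XN (inl b) (inr (inl a)) · v a = hv v b − (W₀·((P·W₀)⁻¹·(P·hv v))) b` — the entries the N leg `hLN` reads (its `12` block) against the nested direction
the H-side rows read (`hbtop : hb (n+1) v = hv v`). -/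
theorem XN_inl_inr_inl_sum_eq
    {H₀ : Matrix ν ν 𝕜} {Q₁₀ : Matrix μ ν 𝕜} {τ₁ : Matrix ρ₁ ν 𝕜} {Q₂₀ : Matrix κ μ 𝕜} {τ₂ : Matrix ρ₂ μ 𝕜}
    {W₀ : Matrix ν (ρ₂ ⊕ ρ₁) 𝕜} {P : Matrix (ρ₂ ⊕ ρ₁) ν 𝕜}
    {I : Matrix ν (μ ⊕ ρ₁) 𝕜} {S : Matrix (μ ⊕ ρ₁) (μ ⊕ ρ₁) 𝕜} {𝔔₀ : Matrix κ ν 𝕜}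
    (hI : minOp H₀ (fromRows Q₁₀ τ₁) = I) (hS : effForm H₀ (fromRows Q₁₀ τ₁) = S)
    {hv : (κ → 𝕜) → (ν → 𝕜)} (hhv : ∀ v, hv v = I *ᵥ Sum.elim (minOp S.toBlocks₁₁ (fromRows Q₂₀ τ₂) *ᵥ Sum.elim v 0) 0)
    (h𝔔₀ : Q₂₀ * Q₁₀ = 𝔔₀)
    {XN : Matrix (ν ⊕ (κ ⊕ (ρ₂ ⊕ ρ₁))) (ν ⊕ (κ ⊕ (ρ₂ ⊕ ρ₁))) 𝕜} (hXN : kkt H₀ (fromRows 𝔔₀ P) * XN = 1)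
    (a0 : H₀ * W₀ = 0) (hH₀t : H₀ᵀ = H₀) (b0 : 𝔔₀ * W₀ = 0)
    (hTW : (fromRows (τ₂ * Q₁₀) τ₁ * W₀).det ≠ 0) (hPW : (P * W₀).det ≠ 0)
    (h1 : (kkt H₀ (fromRows Q₁₀ τ₁)).det ≠ 0) (h2 : (kkt S.toBlocks₁₁ (fromRows Q₂₀ τ₂)).det ≠ 0) (v : κ → 𝕜) (b : ν) :
    ∑ a : κ, XN (Sum.inl b) (Sum.inr (Sum.inl a)) * v a = hv v b - (W₀ *ᵥ ((P * W₀)⁻¹ *ᵥ (P *ᵥ hv v))) b := by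
  have e := congrFun (XN_toBlocks₁₂_mulVec_eq_gaugeProj hI hS hhv h𝔔₀ hXN a0 hH₀t b0 hTW hPW h1 h2 v) b
  rw [Pi.sub_apply] at e
  rw [← e]
  simp only [mulVec, dotProduct, Fintype.sum_sum_type, Sum.elim_inl, Sum.elim_inr, Pi.zero_apply, mul_zero, Finset.sum_const_zero, add_zero]
  rfl

end Wrapper

end Summit.QuantumFields.BalabanUV.Beta.FP.TorusOneShotColumnGaugeProj

end
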